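import Literature.Geometry.Lorentzian.DataEmbeddingMapAlong
import Literature.Geometry.Lorentzian.CommonDevelopmentRealise
import Literature.Geometry.Lorentzian.DataEmbeddingOneJetPointwise
import Literature.Geometry.Lorentzian.CauchyProblemLocalUniqueness
import Literature.Geometry.Lorentzian.HypersurfaceRestriction
import HarnessLib

/-!
# Route SwallowTheDatum · item `SubdataDevelopmentsEmbed` (stmt-FinalStateConjecture-10053) —
# the local uniqueness step of the restart (Sbierski 2016, §3.2, proof of Thm. 12)

Second of four files. `exists_restart_of_sliceDevelopments`: from two vacuum data embeddings of the
same slice data with lens developments, isometric open embeddings into the two spacetimes, and a map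
identifying the two slices to first order, local uniqueness
(`hawkingEllis_locallyUnique_vacuumDevelopment`, a hypothesis) gives the restart data: an open set
of the first spacetime containing the slice image as a Cauchy hypersurface and a map into the second
spacetime, smooth/isometric/orientation preserving on it, with the `1`-jet of the given extension at
the slice ("By Theorem 2.4 there exists a GHD `N ⊆ M` of `(S, ḡ_S, k_S)` together with an isometric
embedding `φ : N → M'` such that `φ|_S = ψ|_S` … `(dψ)|_S = (dφ)|_S`", Sbierski 2016, p. 16).
CONDITIONAL on LU. Everything else proved; no definitions, no named facts.
-/

noncomputable section

open Bundle Set Function Filter TopologicalSpace Manifold Topology Metric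
open scoped Manifold ContDiff Topology

namespace Summit.FinalStateConjecture.FinalStateConjecture.Theorems

namespace SubdataDevelopmentsEmbed

open Literature.Geometry.Lorentzian

/-! ### Steps 6–8 in abstract form: from two vacuum data embeddings of the same data with lens
developments and isometric maps into the two spacetimes, to the restart data -/

/-- **The restart data from two local developments of the same slice data** (the part of
Sbierski's argument after the slice data have been set up; §3.2, proof of Thm. 12: "By Theorem 2.4
there exists a GHD `N ⊆ M` of `(S, ḡ_S, k_S)` together with an isometric embedding `φ : N → M'`
such that `φ|_S = ψ|_S` … `(dψ)|_S = (dφ)|_S`"). Let `𝒮a`, `𝒮b` be vacuum data embeddings of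
the same data `D` on `X`, with open connected `V_a ⊇ ι_a(X)`, `V_b ⊇ ι_b(X)` in which the data
hypersurfaces are Cauchy (so that the restrictions are vacuum Cauchy developments of `D`), and let
`χ_a : 𝒮a → 𝒯₁`, `χ_b : 𝒮b → 𝒯₂` be time-orientation preserving isometric open embeddings into
two spacetimes. Suppose a map `e : 𝒮a → 𝒮b` carries `ι_a` to `ι_b` and `ν_a` to `ν_b` (to first
order at the data hypersurface), and `ψ : 𝒯₁ → 𝒯₂` satisfies `ψ ∘ χ_a = χ_b ∘ e` and is
differentiable at the points `χ_a(ι_a(X))`. Then LU (`hawkingEllis_locallyUnique_vacuumDevelopment`)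
gives an open `N' ⊆ χ_a(𝒮a)` of `𝒯₁` containing `S = χ_a(ι_a(X))`, in which `S` is a Cauchy
hypersurface, and `φ : 𝒯₁ → 𝒯₂` smooth, isometric and time-orientation preserving on `N'` with
`φ = ψ` and `dφ = dψ` at every point of `S`: the common development `𝒰` of the two lens
developments is realised inside `𝒯₁` along `χ_a` (`CauchyDevelopment.exists_realised_range`), and
the `1`-jets agree because both `φ` and `ψ` carry `ι₁ = χ_a ∘ ι_a` to `ι₂ = χ_b ∘ ι_b` and the
normal `dχ_a ν_a` to `dχ_b ν_b` (`DataEmbedding.mapAlong`,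
`DataEmbedding.mfderiv_eq_mfderiv_of_mfderiv_normal_eq_at`). CONDITIONAL on LU.
[cite: Sbierski2016AHP, §3.2, proof of Thm. 12 (arXiv: p. 16)] -/
theorem exists_restart_of_sliceDevelopments (hLU : hawkingEllis_locallyUnique_vacuumDevelopment)
    {X : Type} [TopologicalSpace X] [ChartedSpace E3 X] [IsManifold (𝓡 3) ∞ X] [T2Space X]
    [SecondCountableTopology X] [ConnectedSpace X] {D : InitialDataSet (𝓡 3) X}
    (𝒮a 𝒮b : DataEmbedding D) (hva : 𝒮a.IsVacuum) (hvb : 𝒮b.IsVacuum)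
    (Va : Opens 𝒮a.carrier) (hVa : IsConnected (Va : Set 𝒮a.carrier)) (hιa : ∀ y, 𝒮a.embed y ∈ Va)
    (hCa : (𝒮a.metric.restrict PseudoRiemannianMetric.contMDiff_restrict_holds Va).IsCauchyHypersurface
      (𝒮a.timeOrientation.restrict PseudoRiemannianMetric.contMDiff_restrict_holds
        𝒮a.timeOrientation.contMDiff_restrict_holds Va) (range (𝒮a.embedOpens Va hιa)))
    (Vb : Opens 𝒮b.carrier) (hVb : IsConnected (Vb : Set 𝒮b.carrier)) (hιb : ∀ y, 𝒮b.embed y ∈ Vb)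
    (hCb : (𝒮b.metric.restrict PseudoRiemannianMetric.contMDiff_restrict_holds Vb).IsCauchyHypersurface
      (𝒮b.timeOrientation.restrict PseudoRiemannianMetric.contMDiff_restrict_holds
        𝒮b.timeOrientation.contMDiff_restrict_holds Vb) (range (𝒮b.embedOpens Vb hιb)))
    (𝒯₁ 𝒯₂ : Spacetime.{0} 4)
    {χa : 𝒮a.carrier → 𝒯₁.carrier} (hχao : IsOpenEmbedding χa)
    (hχai : 𝒮a.metric.IsIsometricImmersion 𝒯₁.metric.toPseudoRiemannianMetric χa)
    (hχaτ : 𝒮a.timeOrientation.PreservesTimeOrientation χa 𝒯₁.timeOrientation)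
    {χb : 𝒮b.carrier → 𝒯₂.carrier} (hχbo : IsOpenEmbedding χb)
    (hχbi : 𝒮b.metric.IsIsometricImmersion 𝒯₂.metric.toPseudoRiemannianMetric χb)
    (hχbτ : 𝒮b.timeOrientation.PreservesTimeOrientation χb 𝒯₂.timeOrientation)
    {e : 𝒮a.carrier → 𝒮b.carrier} (he : e ∘ 𝒮a.embed = 𝒮b.embed)
    (hed : ∀ y, MDifferentiableAt (𝓡 4) (𝓡 4) e (𝒮a.embed y))
    (heν : ∀ y, mfderiv (𝓡 4) (𝓡 4) e (𝒮a.embed y) (𝒮a.normal y) = 𝒮b.normal y)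
    {ψ : 𝒯₁.carrier → 𝒯₂.carrier} (hψe : ∀ x, ψ (χa x) = χb (e x))
    (hψd : ∀ y, MDifferentiableAt (𝓡 4) (𝓡 4) ψ (χa (𝒮a.embed y))) :
    ∃ (N' : Opens 𝒯₁.carrier) (φ : 𝒯₁.carrier → 𝒯₂.carrier),
      (N' : Set 𝒯₁.carrier) ⊆ range χa ∧ (∀ y, χa (𝒮a.embed y) ∈ N') ∧
      (𝒯₁.metric.restrict PseudoRiemannianMetric.contMDiff_restrict_holds N').IsCauchyHypersurface
        (𝒯₁.timeOrientation.restrict PseudoRiemannianMetric.contMDiff_restrict_holds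
          𝒯₁.timeOrientation.contMDiff_restrict_holds N') (Subtype.val ⁻¹' range (χa ∘ 𝒮a.embed)) ∧
      ContMDiffOn (𝓡 4) (𝓡 4) ∞ φ N' ∧
      (∀ p ∈ N', pullbackBilin (I := 𝓡 4) (I' := 𝓡 4) φ 𝒯₂.metric.val p = 𝒯₁.metric.val p) ∧
      (∀ p ∈ N', 𝒯₂.timeOrientation.IsFutureDirected
        (mfderiv (𝓡 4) (𝓡 4) φ p (𝒯₁.timeOrientation.vectorField p))) ∧
      ∀ y, φ (χa (𝒮a.embed y)) = ψ (χa (𝒮a.embed y)) ∧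
        mfderiv (𝓡 4) (𝓡 4) φ (χa (𝒮a.embed y)) = mfderiv (𝓡 4) (𝓡 4) ψ (χa (𝒮a.embed y)) := by
  classical
  /- the two lens developments -/
  set 𝒟a : VacuumCauchyDevelopment D :=
    { toCauchyDevelopment :=
        { toDataEmbedding := 𝒮a.restrict Va hVa hιa 𝒮a.mdifferentiableAt_embed_normal
          isCauchyHypersurface := hCa }
      isRicciFlat := by
        intro inst
        haveI : (𝒮a.metric.restrict PseudoRiemannianMetric.contMDiff_restrict_holds
            Va).toPseudoRiemannianMetric.HasLeviCivita := inst
        exact 𝒮a.isRicciFlat_restrict Va hva } with h𝒟a_def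
  set 𝒟b : VacuumCauchyDevelopment D :=
    { toCauchyDevelopment :=
        { toDataEmbedding := 𝒮b.restrict Vb hVb hιb 𝒮b.mdifferentiableAt_embed_normal
          isCauchyHypersurface := hCb }
      isRicciFlat := by
        intro inst
        haveI : (𝒮b.metric.restrict PseudoRiemannianMetric.contMDiff_restrict_holds
            Vb).toPseudoRiemannianMetric.HasLeviCivita := inst
        exact 𝒮b.isRicciFlat_restrict Vb hvb } with h𝒟b_def
  /- local uniqueness -/
  obtain ⟨𝒰, hUa, hUb⟩ := hLU X D 𝒟a 𝒟b
  obtain ⟨ja, hjas, hjao, hjai, hjaτ, hjac⟩ := hUa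
  obtain ⟨jb, hjbs, hjbo, hjbi, hjbτ, hjbc⟩ := hUb
  -- the inclusions of the lenses
  have hval_iso_a : (𝒮a.metric.restrict PseudoRiemannianMetric.contMDiff_restrict_holds Va).IsIsometricImmersion
      𝒮a.metric.toPseudoRiemannianMetric (Subtype.val : Va → 𝒮a.carrier) :=
    ⟨contMDiff_subtype_val, fun y ↦ by
      ext v w
      rw [pullbackBilin_apply, mfderiv_subtypeVal]
      rfl⟩
  have hval_iso_b : (𝒮b.metric.restrict PseudoRiemannianMetric.contMDiff_restrict_holds Vb).IsIsometricImmersion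
      𝒮b.metric.toPseudoRiemannianMetric (Subtype.val : Vb → 𝒮b.carrier) :=
    ⟨contMDiff_subtype_val, fun y ↦ by
      ext v w
      rw [pullbackBilin_apply, mfderiv_subtypeVal]
      rfl⟩
  have hval_τ_a : (𝒮a.timeOrientation.restrict PseudoRiemannianMetric.contMDiff_restrict_holds
      𝒮a.timeOrientation.contMDiff_restrict_holds Va).PreservesTimeOrientation
      (Subtype.val : Va → 𝒮a.carrier) 𝒮a.timeOrientation := fun y ↦ by
    rw [mfderiv_subtypeVal]
    exact 𝒮a.timeOrientation.isFutureDirected_vectorField y.1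
  have hval_τ_b : (𝒮b.timeOrientation.restrict PseudoRiemannianMetric.contMDiff_restrict_holds
      𝒮b.timeOrientation.contMDiff_restrict_holds Vb).PreservesTimeOrientation
      (Subtype.val : Vb → 𝒮b.carrier) 𝒮b.timeOrientation := fun y ↦ by
    rw [mfderiv_subtypeVal]
    exact 𝒮b.timeOrientation.isFutureDirected_vectorField y.1
  /- the maps `J = χa ∘ ja`, `K = χb ∘ jb` -/
  set J : 𝒰.carrier → 𝒯₁.carrier := χa ∘ (Subtype.val : Va → 𝒮a.carrier) ∘ ja with hJ_def
  set K : 𝒰.carrier → 𝒯₂.carrier := χb ∘ (Subtype.val : Vb → 𝒮b.carrier) ∘ jb with hK_def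
  have hχas : ContMDiff (𝓡 4) (𝓡 4) ∞ χa := hχai.1
  have hχbs : ContMDiff (𝓡 4) (𝓡 4) ∞ χb := hχbi.1
  have hJo : IsOpenEmbedding J := hχao.comp ((Va.isOpen.isOpenEmbedding_subtypeVal).comp hjao)
  have hJi : 𝒰.metric.IsIsometricImmersion 𝒯₁.metric.toPseudoRiemannianMetric J :=
    hχai.comp (hval_iso_a.comp hjai)
  have hKi : 𝒰.metric.IsIsometricImmersion 𝒯₂.metric.toPseudoRiemannianMetric K :=
    hχbi.comp (hval_iso_b.comp hjbi)
  have hJτ : 𝒰.timeOrientation.PreservesTimeOrientation J 𝒯₁.timeOrientation :=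
    hχaτ.comp (hval_τ_a.comp hjaτ hval_iso_a.2
      ((contMDiff_subtype_val (n := ∞)).mdifferentiable (by simp))
      (hjas.mdifferentiable (by simp))) hχai.2 (hχas.mdifferentiable (by simp))
      (((contMDiff_subtype_val (n := ∞)).comp hjas).mdifferentiable (by simp))
  have hKτ : 𝒰.timeOrientation.PreservesTimeOrientation K 𝒯₂.timeOrientation :=
    hχbτ.comp (hval_τ_b.comp hjbτ hval_iso_b.2
      ((contMDiff_subtype_val (n := ∞)).mdifferentiable (by simp))
      (hjbs.mdifferentiable (by simp))) hχbi.2 (hχbs.mdifferentiable (by simp))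
      (((contMDiff_subtype_val (n := ∞)).comp hjbs).mdifferentiable (by simp))
  have hJc : J ∘ 𝒰.embed = χa ∘ 𝒮a.embed := by
    funext y
    have h : ja (𝒰.embed y) = 𝒟a.embed y := congrFun hjac y
    simp only [hJ_def, Function.comp_apply]
    rw [h]
    rfl
  have hKc : K ∘ 𝒰.embed = χb ∘ 𝒮b.embed := by
    funext y
    have h : jb (𝒰.embed y) = 𝒟b.embed y := congrFun hjbc y
    simp only [hK_def, Function.comp_apply]
    rw [h]
    rfl
  /- realisation inside `𝒯₁` -/
  obtain ⟨N', φ, hN'eq, hι₁N', -, hC', hφs, hφiso, hφτ, -, hφι⟩ :=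
    CauchyDevelopment.exists_realised_range 𝒰.toCauchyDevelopment 𝒯₁ 𝒯₂ hJo hJi hJτ hKi hKτ hJc hKc
  refine ⟨N', φ, ?_, fun y ↦ hι₁N' y, hC', hφs, hφiso, hφτ, fun y ↦ ⟨?_, ?_⟩⟩
  · -- `N' = J(𝒰) ⊆ range χa`
    rw [hN'eq]
    rintro _ ⟨u, rfl⟩
    exact ⟨_, rfl⟩
  · -- `φ = ψ` on `S`
    have h1 : φ (χa (𝒮a.embed y)) = χb (𝒮b.embed y) := congrFun hφι y
    rw [h1, hψe, ← he]
    rfl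
  · -- `dφ = dψ` on `S`: both carry `ι₁` to `ι₂` and `dχa ν_a` to `dχb ν_b`
    set 𝒮₁ : DataEmbedding D := 𝒮a.mapAlong 𝒯₁ hχao hχai hχaτ with h𝒮₁_def
    set 𝒮₂ : DataEmbedding D := 𝒮b.mapAlong 𝒯₂ hχbo hχbi hχbτ with h𝒮₂_def
    have hφd : MDifferentiableAt (𝓡 4) (𝓡 4) φ (χa (𝒮a.embed y)) :=
      ((hφs _ (hι₁N' y)).contMDiffAt (N'.isOpen.mem_nhds (hι₁N' y))).mdifferentiableAt (by simp)
    have hψι : ψ ∘ 𝒮₁.embed = 𝒮₂.embed := by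
      funext y'
      show ψ (χa (𝒮a.embed y')) = χb (𝒮b.embed y')
      rw [hψe, ← he]
      rfl
    have hφι' : φ ∘ 𝒮₁.embed = 𝒮₂.embed := hφι
    -- `dψ (dχa ν_a) = dχb (de ν_a) = dχb ν_b`
    have hψν : mfderiv (𝓡 4) (𝓡 4) ψ (𝒮₁.embed y) (𝒮₁.normal y) = 𝒮₂.normal y := by
      change mfderiv (𝓡 4) (𝓡 4) ψ (χa (𝒮a.embed y))
          (mfderiv (𝓡 4) (𝓡 4) χa (𝒮a.embed y) (𝒮a.normal y)) =
        mfderiv (𝓡 4) (𝓡 4) χb (𝒮b.embed y) (𝒮b.normal y)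
      have hχad : MDifferentiableAt (𝓡 4) (𝓡 4) χa (𝒮a.embed y) :=
        (hχas _).mdifferentiableAt (by simp)
      have hχbd : MDifferentiableAt (𝓡 4) (𝓡 4) χb (e (𝒮a.embed y)) :=
        (hχbs _).mdifferentiableAt (by simp)
      have hcomp : ψ ∘ χa = χb ∘ e := funext hψe
      have h1 := mfderiv_comp (𝒮a.embed y) (hψd y) hχad
      have h2 := mfderiv_comp (𝒮a.embed y) hχbd (hed y)
      rw [hcomp] at h1
      have h3 := (h1.symm.trans h2)
      have h4 := congrArg (fun L ↦ L (𝒮a.normal y)) h3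
      have h5 : mfderiv (𝓡 4) (𝓡 4) ψ (χa (𝒮a.embed y))
          (mfderiv (𝓡 4) (𝓡 4) χa (𝒮a.embed y) (𝒮a.normal y)) =
          mfderiv (𝓡 4) (𝓡 4) χb (e (𝒮a.embed y))
            (mfderiv (𝓡 4) (𝓡 4) e (𝒮a.embed y) (𝒮a.normal y)) := h4
      have hey : e (𝒮a.embed y) = 𝒮b.embed y := congrFun he y
      refine h5.trans ?_
      rw [heν y]
      exact congrArg (fun q ↦ mfderiv (𝓡 4) (𝓡 4) χb q (𝒮b.normal y)) hey
    have key := DataEmbedding.mfderiv_eq_mfderiv_of_mfderiv_normal_eq_at 𝒮₁ 𝒮₂ (ψ := ψ) (ψ' := φ)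
      (x := y) (hψd y) hψι hψν hφd (hφiso _ (hι₁N' y)) (hφτ _ (hι₁N' y)) hφι'
    ext w
    exact (key w).symm

end SubdataDevelopmentsEmbed

end Summit.FinalStateConjecture.FinalStateConjecture.Theorems

end
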